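import Mathlib
import HarnessLib
import Summits.Parity.GeneralizedHardyLittlewood.Theses.LiouvilleShiftedTables
import Literature.NumberTheory.Sieve.LinearEquationsInPrimes

/-!
# Sketch — crux `PairsToGHL` (stmt-Parity-9389), crux-ideate round 1, ideator 3 (gen 2)

Card `resonance-free-clusters`: the EXACT reach of the crux hypothesis `PairsHL` inside
`GeneralizedHardyLittlewood` — systems in any dimension made of ONE translate pair
`(θ(n) + b, θ(n) + b + h)` (bounded shift `h`) plus SINGLETON forms (pairwise non-parallel linear
parts, none parallel to `θ̇`), subject to the local RESONANCE-FREE condition: for every prime `p`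
the number `M_p(c)` of residues `r ∈ (ℤ/p)^d` with `θ(r) = c` at which all singleton forms are
units is CONSTANT on the pair-admissible classes `c ∉ {0, -h}`. On that family the generalised
von Neumann theorem at the singleton indices (Green–Tao 2010, App. C, normal form needed only AT
the eliminated index, read p. 40–41 of arXiv:math/0606088) with the pair majorant
`ν_b ν_{b+h}` (Goldston–Yıldırım estimate = Green–Tao 2010 Thm D.3, which is stated for ALL
non-degenerate systems, translates included) and the Green–Tao–Ziegler uniformity of
`Λ'_{b,W} - 1` reduce the count to the TOTAL pair count against a `W`-periodic weight that is
constant on the pair's support — so fixed-shift `PairsHL` is the complete arithmetic input.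

Contents (all `def`s elaborate; theorems marked PROVED are sorry-free; nothing else is claimed):
* `PairsHL`, `pairsToGHL_iff` (rfl against the route decl);
* `HLFor Ψ` — the GHL asymptotic for one system, all convex bodies; `ghl_imp_hlFor` (PROVED);
* `twinGoldbachSystem = (n₁, n₁+2, n₂, n₁+2n₂)` (admissible: all four odd), the card's lead
  instance; `FirstLemma := PairsHL → HLFor twinGoldbachSystem`;
* `ClusterSystem`, `evalMod`, `localMultiplicity` (= `M_p(c)`), `IsResonanceFree`,
  `ResonanceFreeReach` (the card's theorem-candidate, typed), `firstLemma_of_reach` (PROVED);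
* calibration by `native_decide`: `M_5` is constant (= 3) on the admissible classes for the lead
  instance and NOT constant for the resonant contrast `(n₁, n₁+2, n₂, n₁+n₂+1)` (`M_5(4) = 4`).
-/

namespace Summit.Parity.GeneralizedHardyLittlewood.Cruxes.PairsToGHL.Ideator3g2

open Literature.NumberTheory.Sieve
open scoped BigOperators
open Filter Finset

/-! ## §1 The crux, by name -/

/-- The crux hypothesis (fixed-shift Hardy–Littlewood pairs, Λ-form), BY NAME from the route file. -/
abbrev PairsHL : Prop :=
  Summit.Parity.GeneralizedHardyLittlewood.Theses.LiouvilleShiftedTables.PairsHL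

/-- `PairsToGHL` is literally `PairsHL → GeneralizedHardyLittlewood` (rfl check against the route decl). -/
theorem pairsToGHL_iff :
    Summit.Parity.GeneralizedHardyLittlewood.Theses.LiouvilleShiftedTables.PairsToGHL ↔
      (PairsHL → _root_.GeneralizedHardyLittlewood) :=
  Iff.rfl

/-! ## §2 The GHL asymptotic for ONE system -/

/-- `HLFor Ψ`: Green–Tao Conj. 1.2 for the single system `Ψ`, uniformly over convex
`K ⊆ [-N,N]^d`. -/
def HLFor {d t : ℕ} (Ψ : Fin t → AffLinForm d) : Prop :=
  ∀ ε : ℝ, 0 < ε → ∃ N₀ : ℕ, ∀ N : ℕ, N₀ ≤ N → ∀ K : Set (Fin d → ℝ), Convex ℝ K →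
    K ⊆ realBox d N → |vonMangoldtSum Ψ K N - archFactor Ψ K * singularProduct Ψ| ≤ ε * (N : ℝ) ^ d

/-- Sanity: GHL gives `HLFor Ψ` for every non-degenerate `Ψ` of bounded size (PROVED). -/
theorem ghl_imp_hlFor (hG : _root_.GeneralizedHardyLittlewood) {d t : ℕ} (hd : 1 ≤ d) (ht : 1 ≤ t)
    (Ψ : Fin t → AffLinForm d) (hΨ : IsNondegenerateSystem Ψ) (L : ℕ)
    (hL : ∀ N : ℕ, 1 ≤ N → affLinSize Ψ (N : ℝ) ≤ (L : ℝ)) : HLFor Ψ := by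
  intro ε hε
  obtain ⟨N₀, hN₀⟩ := hG d t L hd ht ε hε
  refine ⟨max N₀ 1, fun N hN K hK hKsub => ?_⟩
  exact hN₀ N (le_trans (le_max_left _ _) hN) Ψ hΨ (hL N (le_trans (le_max_right _ _) hN)) K hK hKsub

/-! ## §3 The lead instance: twin primes `(n₁, n₁+2)` and the Goldbach-type pair `(n₂, n₁ + 2 n₂)` -/

/-- `Ψ₀(n₁, n₂) = (n₁, n₁ + 2, n₂, n₁ + 2 n₂)`: a twin pair plus two singleton forms; all four values
are odd when `n₁, n₂` are odd, so there is no local obstruction (`β₂ = 4`, `∏_p β_p > 0`). -/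
def twinGoldbachSystem : Fin 4 → AffLinForm 2 :=
  ![⟨![1, 0], 0⟩, ⟨![1, 0], 2⟩, ⟨![0, 1], 0⟩, ⟨![1, 2], 0⟩]

/-- FIRST LEMMA of the card (typed claim): fixed-shift Hardy–Littlewood pairs already give the
Green–Tao asymptotic for `Ψ₀`, over every convex `K ⊆ [-N, N]²`. -/
def FirstLemma : Prop :=
  PairsHL → HLFor twinGoldbachSystem

/-- `Ψ₀` satisfies Green–Tao's standing hypotheses (PROVED: test vectors `(0,0), (1,0), (0,1)`). -/
theorem isNondegenerateSystem_twinGoldbach : IsNondegenerateSystem twinGoldbachSystem := by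
  refine ⟨fun i => ?_, fun i j hij a b hab => ?_⟩
  · fin_cases i <;> simp [twinGoldbachSystem]
  · have h0 := hab ![0, 0]
    have h1 := hab ![1, 0]
    have h2 := hab ![0, 1]
    fin_cases i <;> fin_cases j <;>
      first
        | exact absurd rfl hij
        | (simp [twinGoldbachSystem, AffLinForm.eval, Fin.sum_univ_two] at h0 h1 h2; omega)

/-- `‖Ψ₀‖_N = 6 + 2/N ≤ 8` for `N ≥ 1` (PROVED). -/
theorem affLinSize_twinGoldbach (N : ℕ) (hN : 1 ≤ N) : affLinSize twinGoldbachSystem (N : ℝ) ≤ (8 : ℕ) := by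
  have hN' : (1 : ℝ) ≤ N := by exact_mod_cast hN
  have h2 : |(2 : ℝ) / N| ≤ 2 := by
    rw [abs_of_nonneg (by positivity)]
    exact div_le_self (by norm_num) hN'
  simp only [affLinSize, twinGoldbachSystem, Fin.sum_univ_four, Fin.sum_univ_two, Matrix.cons_val_zero,
    Matrix.cons_val_one, Matrix.head_cons, Matrix.cons_val_two, Matrix.tail_cons, Matrix.cons_val_three]
  norm_num
  linarith [h2, abs_nonneg ((2 : ℝ) / N)]

/-- Calibration: the first lemma's conclusion is a genuine instance of GHL (PROVED). -/
theorem ghl_imp_hlFor_twinGoldbach (hG : _root_.GeneralizedHardyLittlewood) : HLFor twinGoldbachSystem :=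
  ghl_imp_hlFor hG (by norm_num) (by norm_num) _ isNondegenerateSystem_twinGoldbach 8 affLinSize_twinGoldbach

/-! ## §4 The resonance-free family -/

/-- Value of an affine form reduced mod `p`, on representatives `r ∈ {0,…,p-1}^d`
(same convention as `Literature.NumberTheory.Sieve.localFactor`). -/
def evalMod {d : ℕ} (ψ : AffLinForm d) (p : ℕ) (r : Fin d → ℕ) : ℤ :=
  (ψ.eval fun j => (r j : ℤ)) % (p : ℤ)

/-- A SINGLE-CLUSTER system: one translate pair `(base, base + shift)` and `u` singleton forms. -/
structure ClusterSystem (d u : ℕ) where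
  /-- the first form `θ` of the pair -/
  base : AffLinForm d
  /-- the internal shift `h`: the second form of the pair is `θ + h` -/
  shift : ℤ
  /-- the singleton forms `σ₀, …, σ_{u-1}` -/
  single : Fin u → AffLinForm d

namespace ClusterSystem

variable {d u : ℕ}

/-- the second form of the pair, `θ + h` -/
def second (S : ClusterSystem d u) : AffLinForm d :=
  ⟨S.base.coeff, S.base.const + S.shift⟩

/-- the full system `(θ, θ + h, σ₀, …, σ_{u-1}) : Fin (u+2) → AffLinForm d` -/
def toSystem (S : ClusterSystem d u) : Fin (u + 2) → AffLinForm d :=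
  Fin.cons S.base (Fin.cons S.second S.single)

/-- `θ` together with the singletons — required to have pairwise non-parallel linear parts
(`IsFiniteComplexitySystem`), i.e. the pair is the ONLY parallel cluster. -/
def skeleton (S : ClusterSystem d u) : Fin (u + 1) → AffLinForm d :=
  Fin.cons S.base S.single

/-- `M_p(c) = #{r ∈ {0,…,p-1}^d : θ(r) ≡ c, σ_i(r) ≢ 0 (mod p) ∀ i}` — the number of residues
of the free variables above the pair-class `c` at which every singleton form is a unit mod `p`. -/
def localMultiplicity (S : ClusterSystem d u) (p : ℕ) (c : ℤ) : ℕ :=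
  ((Fintype.piFinset fun _ : Fin d => range p).filter fun r =>
      evalMod S.base p r = c % (p : ℤ) ∧ ∀ i, evalMod (S.single i) p r ≠ 0).card

/-- RESONANCE-FREE: for every prime `p`, `M_p` is constant on the pair-admissible classes
`c ≢ 0, c ≢ -h (mod p)`. (For `p` larger than a constant of the system this holds iff every
collision value of two singleton forms, a rational number, is `0` or `-h`; so it is a finite check.) -/
def IsResonanceFree (S : ClusterSystem d u) : Prop :=
  ∀ p : ℕ, p.Prime → ∀ c c' : ℤ,
    c % (p : ℤ) ≠ 0 → (c + S.shift) % (p : ℤ) ≠ 0 → c' % (p : ℤ) ≠ 0 → (c' + S.shift) % (p : ℤ) ≠ 0 →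
      S.localMultiplicity p c = S.localMultiplicity p c'

end ClusterSystem

/-- THE CARD'S THEOREM-CANDIDATE (typed): on the resonance-free single-cluster family, fixed-shift
pairs (the crux hypothesis, nothing more) give the Green–Tao asymptotic in every dimension. -/
def ResonanceFreeReach : Prop :=
  PairsHL → ∀ (d u : ℕ) (S : ClusterSystem d u), 1 ≤ d → S.shift ≠ 0 →
    IsNondegenerateSystem S.toSystem → IsFiniteComplexitySystem S.skeleton → S.IsResonanceFree →
      HLFor S.toSystem

/-- The lead instance as a cluster system: base `n₁`, shift `2`, singletons `n₂`, `n₁ + 2n₂`. -/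
def twinGoldbachCluster : ClusterSystem 2 2 :=
  ⟨⟨![1, 0], 0⟩, 2, ![⟨![0, 1], 0⟩, ⟨![1, 2], 0⟩]⟩

/-- The resonant contrast `(n₁, n₁+2, n₂, n₁+n₂+1)`: the singletons `n₂`, `n₁+n₂+1` collide at
`n₁ ≡ -1`, an ADMISSIBLE twin class for every `p ≥ 5`. -/
def resonantCluster : ClusterSystem 2 2 :=
  ⟨⟨![1, 0], 0⟩, 2, ![⟨![0, 1], 0⟩, ⟨![1, 1], 1⟩]⟩

theorem twinGoldbachCluster_toSystem : twinGoldbachCluster.toSystem = twinGoldbachSystem := by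
  funext i
  fin_cases i <;> rfl

theorem twinGoldbachCluster_skeleton :
    twinGoldbachCluster.skeleton = ![⟨![1, 0], 0⟩, ⟨![0, 1], 0⟩, ⟨![1, 2], 0⟩] := by
  funext i
  fin_cases i <;> rfl

/-- The pair `(n₁, n₁+2)` is the ONLY parallel cluster of `Ψ₀`: base and singletons have pairwise
non-parallel linear parts (PROVED). -/
theorem isFiniteComplexity_twinGoldbach_skeleton : IsFiniteComplexitySystem twinGoldbachCluster.skeleton := by
  rw [twinGoldbachCluster_skeleton]
  intro i j hij a b hab
  have h0 := congrFun hab 0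
  have h1 := congrFun hab 1
  fin_cases i <;> fin_cases j <;>
    first
      | exact absurd rfl hij
      | (simp at h0 h1; omega)

/-- The first lemma is the lead instance of the reach statement (PROVED, pure logic). -/
theorem firstLemma_of_reach (hR : ResonanceFreeReach)
    (hnd : IsNondegenerateSystem twinGoldbachCluster.toSystem)
    (hfc : IsFiniteComplexitySystem twinGoldbachCluster.skeleton)
    (hrf : twinGoldbachCluster.IsResonanceFree) : FirstLemma := by
  intro hP
  rw [← twinGoldbachCluster_toSystem]
  exact hR hP 2 2 twinGoldbachCluster (by norm_num) (by norm_num [twinGoldbachCluster]) hnd hfc hrf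

/-! ## §5 Calibration of the resonance criterion at `p = 5` (kernel/native computations)
Admissible twin classes mod 5 for shift 2: `c ∈ {1, 2, 4}`. -/

/-- Lead instance: `M_5(1) = M_5(2) = M_5(4) = 3` (= `#{r₂ ≢ 0 : c + 2 r₂ ≢ 0}`): constant. -/
example : twinGoldbachCluster.localMultiplicity 5 1 = 3 ∧ twinGoldbachCluster.localMultiplicity 5 2 = 3 ∧
    twinGoldbachCluster.localMultiplicity 5 4 = 3 := by
  native_decide

/-- Resonant contrast: `M_5(1) = M_5(2) = 3` but `M_5(4) = 4` — class `-1 mod 5` of the twins is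
weighted by `4/3`, so the count of `(n₁, n₁+2, n₂, n₁+n₂+1)` sees twins IN A CLASS mod 5, which
`PairsHL` does not contain (folder `toy_res.py`: measured ratios 1.32 / 1.18 / 1.10 at p = 5, 7, 11
against the predicted `(p-1)/(p-2)` = 1.33 / 1.20 / 1.11). -/
example : resonantCluster.localMultiplicity 5 1 = 3 ∧ resonantCluster.localMultiplicity 5 2 = 3 ∧
    resonantCluster.localMultiplicity 5 4 = 4 := by
  native_decide

end Summit.Parity.GeneralizedHardyLittlewood.Cruxes.PairsToGHL.Ideator3g2
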